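import Literature.Computability.Complexity.CHIteratedAddition
import Literature.Computability.Complexity.CHModArith
import Literature.Computability.Complexity.CRRParity
import HarnessLib

/-!
# The parity bit of a Chinese-remainder fraction sum inside the counting hierarchy

Toolkit file (theorems only) of the scaled-up `FOM + MAJ` calculus: the `CH` side of the
conversion from Chinese remainder representation to binary (Hesse–Allender–Barrington, JCSS 65
(2002), §4, Lemmas 4.2–4.3; Bürgisser, ECCC TR06-113, Thm. 3.4). Given

* a `CH`-graph short function `U` on records `r = ⟨v, bin q⟩` (the CRT digits `u_q` of a number
  attached to the base word `v`),
* polynomial-time numeral functions `Rf v` (the precision `R`) and `Kf v` (an additive constant),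
* a `CH` language `Bset` of records ("`q` is a base prime for `v`") on which `q` is odd and
  `U r < q`,

the family `G r = [q = 0] · val (Kf v) + [r ∈ Bset] · ⌊U r · 2ᴿ / q⌋` has a `CH` bit predicate
(`fracFamilyBits_mem_CH`: bit `e` of `⌊u 2ᴿ/q⌋` is the parity of `u · 2^{R-e} mod q`, HAB
Lemma 4.2, a `P` relation into which `U` is substituted), hence by iterated addition
(`CHIteratedAddition.lean`) so has `v ↦ ∑_{q < 2^{p|v|}} G ⟨v, bin q⟩ = val (Kf v) + ∑_{q ∈ base} ⌊u_q 2ᴿ/q⌋`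
(`fracSumBits_mem_CH`), and in particular its bit `R - 1` is a `CH` predicate of `v`
(`fracSumBit_mem_CH`) — the bit which, by `CRRParity.testBit_fracSum_eq`, is the parity of the
represented number. No new definitions.

## References

* W. Hesse, E. Allender, D. A. M. Barrington, JCSS 65 (2002), §4, Lemmas 4.2–4.3.
* P. Bürgisser, ECCC TR06-113 (2006), Thm. 3.4.
-/

namespace Literature.Computability.Complexity

open _root_.Computability Polynomial PRelSigma TTClosure Brick PPSharpP ThresholdPP Plumb Finset

/-! ### Parity of a numeral -/

/-- The value of a bit string is odd iff its first (least significant) bit is `1`. [folklore] -/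
theorem bitsToNat_mod_two_eq_one_iff (w : List Bool) : bitsToNat w % 2 = 1 ↔ w.head? = some true := by
  cases w with
  | nil => simp
  | cons b l => cases b <;> simp [bitsToNat_cons, Nat.add_mod]

/-- **`{w | val w is odd} ∈ P`** (the regular test "first bit is `1`"). [folklore] -/
theorem oddVal_mem_P : ({w | bitsToNat w % 2 = 1} : Language Bool) ∈ Classes.P :=
  mem_P_of_iff (HeadIs_mem_P true) _ fun w => bitsToNat_mod_two_eq_one_iff w

/-! ### The bit relation of the fractions `⌊u 2ᴿ / q⌋` (HAB Lemma 4.2) -/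

section FracBits

variable {U : List Bool → ℕ} {pU : Polynomial ℕ} {Rf Kf : List Bool → List Bool} {Bset : Language Bool}

/-- **The bit test of the fractions is a `P` relation.** On `z' = ⟨bin u, ⟨⟨v, q⟩, e⟩⟩`:
"`val e < R` and `u · (2^{R - val e} mod val q) mod val q` is odd", `R = val (Rf v)` (with the
`q ≤ 1 ↦ 0` convention of the `powMod` atom). [cite: HesseAllenderBarrington2002, Lemma 4.2] -/
theorem fracBitRel_mem_P (hRf : Rf ∈ FP) :
    ({z | bitsToNat (sndP (sndP z)) < bitsToNat (Rf (fstP (fstP (sndP z)))) ∧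
        bitsToNat (fstP z) *
            (if bitsToNat (sndP (fstP (sndP z))) ≤ 1 then 0
              else 2 ^ (bitsToNat (Rf (fstP (fstP (sndP z)))) - bitsToNat (sndP (sndP z))) % bitsToNat (sndP (fstP (sndP z)))) %
          bitsToNat (sndP (fstP (sndP z))) % 2 = 1} : Language Bool) ∈ Classes.P := by
  -- `e < R`
  have hLt : (pairFn (sndP ∘ sndP) (Rf ∘ fstP ∘ fstP ∘ sndP) ⁻¹' ({u | bitsToNat (fstP u) < bitsToNat (sndP u)} : Language Bool)) ∈
      Classes.P :=
    preimage_mem_P ltVal_mem_P (pairFn_mem_FP (comp_mem_FP sndP_mem_FP sndP_mem_FP)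
      (comp_mem_FP hRf (comp_mem_FP fstP_mem_FP (comp_mem_FP fstP_mem_FP sndP_mem_FP))))
  -- the odd test on `remFn ⟨prodFn ⟨u, modExpFn ⟨2, ⟨R - e, q⟩⟩⟩, q⟩`
  have hF : remFn ∘ pairFn (prodFn ∘ pairFn fstP (modExpFn ∘ pairFn (fun _ => encodeNat 2)
      (pairFn (subFn ∘ pairFn (Rf ∘ fstP ∘ fstP ∘ sndP) (sndP ∘ sndP)) (sndP ∘ fstP ∘ sndP)))) (sndP ∘ fstP ∘ sndP) ∈ FP :=
    comp_mem_FP remFn_mem_FP (pairFn_mem_FP (comp_mem_FP prodFn_mem_FP (pairFn_mem_FP fstP_mem_FP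
      (comp_mem_FP modExpFn_mem_FP (pairFn_mem_FP (const_mem_FP _) (pairFn_mem_FP
        (comp_mem_FP subFn_mem_FP (pairFn_mem_FP (comp_mem_FP hRf (comp_mem_FP fstP_mem_FP (comp_mem_FP fstP_mem_FP sndP_mem_FP)))
          (comp_mem_FP sndP_mem_FP sndP_mem_FP)))
        (comp_mem_FP sndP_mem_FP (comp_mem_FP fstP_mem_FP sndP_mem_FP)))))))
      (comp_mem_FP sndP_mem_FP (comp_mem_FP fstP_mem_FP sndP_mem_FP)))
  have hOdd := preimage_mem_P oddVal_mem_P hF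
  refine mem_P_of_iff (inter_mem_P hLt hOdd) _ fun z => ?_
  rw [memL_inf']
  change _ ↔ bitsToNat (fstP (pairFn (sndP ∘ sndP) (Rf ∘ fstP ∘ fstP ∘ sndP) z)) <
      bitsToNat (sndP (pairFn (sndP ∘ sndP) (Rf ∘ fstP ∘ fstP ∘ sndP) z)) ∧
    bitsToNat ((remFn ∘ pairFn (prodFn ∘ pairFn fstP (modExpFn ∘ pairFn (fun _ => encodeNat 2)
      (pairFn (subFn ∘ pairFn (Rf ∘ fstP ∘ fstP ∘ sndP) (sndP ∘ sndP)) (sndP ∘ fstP ∘ sndP)))) (sndP ∘ fstP ∘ sndP)) z) % 2 = 1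
  simp only [pairFn_apply, Function.comp_apply, fstP_boolPair, sndP_boolPair, remFn_boolPair, prodFn_boolPair,
    bitsToNat_encodeNat, bitsToNat_modExpFn, subFn_boolPair]
  exact Iff.rfl

/-- **The bits of the fractions `⌊U r · 2ᴿ / q⌋` form a `CH` language** (substitute the `CH`-graph
function `U` into the `P` relation): on `z = ⟨r, e⟩`, `r = ⟨v, q⟩`,
"`val e < R ∧ U r · (2^{R - val e} mod val q) mod val q` is odd". [cite: HesseAllenderBarrington2002, Lemma 4.2] -/
theorem fracBit_mem_CH (hU : {z | U (fstP z) = bitsToNat (sndP z)} ∈ CH) (hUb : ∀ w, U w < 2 ^ pU.eval w.length)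
    (hRf : Rf ∈ FP) :
    ({z | bitsToNat (sndP z) < bitsToNat (Rf (fstP (fstP z))) ∧
        U (fstP z) *
            (if bitsToNat (sndP (fstP z)) ≤ 1 then 0
              else 2 ^ (bitsToNat (Rf (fstP (fstP z))) - bitsToNat (sndP z)) % bitsToNat (sndP (fstP z))) %
          bitsToNat (sndP (fstP z)) % 2 = 1} : Language Bool) ∈ CH := by
  refine mem_CH_of_iff (rel_apply_mem_CH (P_subset_CH (fracBitRel_mem_P hRf)) hU hUb fstP_mem_FP) _ fun z => ?_
  change _ ↔ boolPair (encodeNat (U (fstP z))) z ∈ ({z | bitsToNat (sndP (sndP z)) < bitsToNat (Rf (fstP (fstP (sndP z)))) ∧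
        bitsToNat (fstP z) *
            (if bitsToNat (sndP (fstP (sndP z))) ≤ 1 then 0
              else 2 ^ (bitsToNat (Rf (fstP (fstP (sndP z)))) - bitsToNat (sndP (sndP z))) % bitsToNat (sndP (fstP (sndP z)))) %
          bitsToNat (sndP (fstP (sndP z))) % 2 = 1} : Language Bool)
  change _ ↔ bitsToNat (sndP (sndP (boolPair (encodeNat (U (fstP z))) z))) <
      bitsToNat (Rf (fstP (fstP (sndP (boolPair (encodeNat (U (fstP z))) z))))) ∧
    bitsToNat (fstP (boolPair (encodeNat (U (fstP z))) z)) *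
        (if bitsToNat (sndP (fstP (sndP (boolPair (encodeNat (U (fstP z))) z)))) ≤ 1 then 0
          else 2 ^ (bitsToNat (Rf (fstP (fstP (sndP (boolPair (encodeNat (U (fstP z))) z))))) -
            bitsToNat (sndP (sndP (boolPair (encodeNat (U (fstP z))) z)))) %
            bitsToNat (sndP (fstP (sndP (boolPair (encodeNat (U (fstP z))) z))))) %
      bitsToNat (sndP (fstP (sndP (boolPair (encodeNat (U (fstP z))) z)))) % 2 = 1
  simp only [fstP_boolPair, sndP_boolPair, bitsToNat_encodeNat]
  exact Iff.rfl

/-- **Semantics of the bit relation** (HAB Lemma 4.2): for odd `q` and `u < q` the relation holds at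
`(u, q, R, e)` iff bit `e` of `⌊u 2ᴿ / q⌋` is `1`. [cite: HesseAllenderBarrington2002, Lemma 4.2] -/
theorem fracBitRel_iff {u q : ℕ} (hq : q % 2 = 1) (hu : u < q) (R e : ℕ) :
    (e < R ∧ u * (if q ≤ 1 then 0 else 2 ^ (R - e) % q) % q % 2 = 1) ↔ (u * 2 ^ R / q).testBit e = true := by
  rw [CRRParity.testBit_mul_two_pow_div hq hu, Bool.and_eq_true, decide_eq_true_iff, decide_eq_true_iff]
  refine and_congr Iff.rfl ?_
  by_cases hq1 : q ≤ 1
  · have hq' : q = 1 := by omega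
    subst hq'
    simp [Nat.mod_one]
  · rw [if_neg hq1, Nat.mul_mod, Nat.mod_mod, ← Nat.mul_mod]

/-! ### The family of fractions and its bits -/

/-- **The family of fractions has a `CH` bit predicate.** On records `r = ⟨v, bin q⟩` let
`G r = val (Kf v)` if `q = 0`, `G r = ⌊U r · 2^{val (Rf v)} / q⌋` if `r ∈ Bset`, and `G r = 0`
otherwise; if `Bset ∈ CH` contains only records with `q` odd and `U r < q`, then
`{⟨r, e⟩ | bit (val e) of G r} ∈ CH` (a Boolean combination of the `P` bit test on the numeral
`Kf v`, membership in `Bset`, and `fracBit_mem_CH`). [cite: HesseAllenderBarrington2002, Lemma 4.3] -/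
theorem fracFamilyBits_mem_CH [DecidablePred (· ∈ Bset)] (hU : {z | U (fstP z) = bitsToNat (sndP z)} ∈ CH)
    (hUb : ∀ w, U w < 2 ^ pU.eval w.length) (hRf : Rf ∈ FP) (hKf : Kf ∈ FP) (hB : Bset ∈ CH)
    (hBU : ∀ r ∈ Bset, bitsToNat (sndP r) % 2 = 1 ∧ U r < bitsToNat (sndP r)) :
    {z | ((if bitsToNat (sndP (fstP z)) = 0 then bitsToNat (Kf (fstP (fstP z)))
          else if fstP z ∈ Bset then U (fstP z) * 2 ^ bitsToNat (Rf (fstP (fstP z))) / bitsToNat (sndP (fstP z))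
          else 0).testBit (bitsToNat (sndP z))) = true} ∈ CH := by
  -- `A = {z | q = 0}`, `BitK = {z | bit (val e) of val (Kf v)}`, `Bmem = {z | fstP z ∈ Bset}`
  have hA : ({z | bitsToNat (sndP (fstP z)) = 0} : Language Bool) ∈ Classes.P :=
    preimage_mem_P valZero_mem_P (comp_mem_FP sndP_mem_FP fstP_mem_FP)
  have hBitK : (pairFn (Kf ∘ fstP ∘ fstP) sndP ⁻¹'
      ({w | (bitsToNat (fstP w)).testBit (bitsToNat (sndP w)) = true} : Language Bool)) ∈ Classes.P :=
    preimage_mem_P testBitLang_mem_P (pairFn_mem_FP (comp_mem_FP hKf (comp_mem_FP fstP_mem_FP fstP_mem_FP)) sndP_mem_FP)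
  have hBmem : fstP ⁻¹' Bset ∈ CH := preimage_mem_CH hB fstP_mem_FP
  have hFrac := fracBit_mem_CH hU hUb hRf
  have hL := union_mem_CH (P_subset_CH (inter_mem_P hA hBitK))
    (inter_mem_CH (P_subset_CH ((compl_mem_P_iff).2 hA)) (inter_mem_CH hBmem hFrac))
  refine mem_CH_of_iff hL _ fun z => ?_
  rw [memL_sup, memL_inf', memL_inf', memL_inf', memL_compl]
  change ((if bitsToNat (sndP (fstP z)) = 0 then bitsToNat (Kf (fstP (fstP z)))
      else if fstP z ∈ Bset then U (fstP z) * 2 ^ bitsToNat (Rf (fstP (fstP z))) / bitsToNat (sndP (fstP z))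
      else 0).testBit (bitsToNat (sndP z)) = true) ↔ (bitsToNat (sndP (fstP z)) = 0 ∧
      (bitsToNat (fstP (pairFn (Kf ∘ fstP ∘ fstP) sndP z))).testBit (bitsToNat (sndP (pairFn (Kf ∘ fstP ∘ fstP) sndP z))) = true) ∨
    (¬ bitsToNat (sndP (fstP z)) = 0 ∧ fstP z ∈ Bset ∧
      (bitsToNat (sndP z) < bitsToNat (Rf (fstP (fstP z))) ∧
        U (fstP z) *
            (if bitsToNat (sndP (fstP z)) ≤ 1 then 0
              else 2 ^ (bitsToNat (Rf (fstP (fstP z))) - bitsToNat (sndP z)) % bitsToNat (sndP (fstP z))) %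
          bitsToNat (sndP (fstP z)) % 2 = 1))
  simp only [pairFn_apply, Function.comp_apply, fstP_boolPair, sndP_boolPair]
  by_cases h0 : bitsToNat (sndP (fstP z)) = 0
  · rw [if_pos h0]
    simp only [h0, true_and, not_true_eq_false, false_and, or_false]
  · rw [if_neg h0]
    simp only [h0, false_and, false_or, not_false_eq_true, true_and]
    by_cases hmem : fstP z ∈ Bset
    · rw [if_pos hmem]
      simp only [hmem, true_and]
      obtain ⟨hodd, hlt⟩ := hBU _ hmem
      exact (fracBitRel_iff hodd hlt _ _).symm
    · rw [if_neg hmem]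
      simp only [hmem, false_and, iff_false, Nat.zero_testBit]
      exact Bool.false_ne_true

/-- **The fraction sum has a `CH` bit predicate** (iterated addition of the family over
`q < 2^{p|v|}`): `{⟨v, t⟩ | bit (val t) of ∑_{q < 2^{p|v|}} G ⟨v, bin q⟩} ∈ CH`. [cite: HesseAllenderBarrington2002, Lemma 4.3] -/
theorem fracSumBits_mem_CH [DecidablePred (· ∈ Bset)] (hU : {z | U (fstP z) = bitsToNat (sndP z)} ∈ CH)
    (hUb : ∀ w, U w < 2 ^ pU.eval w.length) (hRf : Rf ∈ FP) (hKf : Kf ∈ FP) (hB : Bset ∈ CH)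
    (hBU : ∀ r ∈ Bset, bitsToNat (sndP r) % 2 = 1 ∧ U r < bitsToNat (sndP r)) (p : Polynomial ℕ) :
    {z | (∑ i ∈ range (2 ^ p.eval (fstP z).length),
        (if bitsToNat (sndP (boolPair (fstP z) (encodeNat i))) = 0 then bitsToNat (Kf (fstP (boolPair (fstP z) (encodeNat i))))
          else if boolPair (fstP z) (encodeNat i) ∈ Bset then
            U (boolPair (fstP z) (encodeNat i)) * 2 ^ bitsToNat (Rf (fstP (boolPair (fstP z) (encodeNat i)))) /
              bitsToNat (sndP (boolPair (fstP z) (encodeNat i)))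
          else 0)).testBit (bitsToNat (sndP z)) = true} ∈ CH :=
  iterSum_testBit_mem_CH p
    (G := fun r => if bitsToNat (sndP r) = 0 then bitsToNat (Kf (fstP r))
      else if r ∈ Bset then U r * 2 ^ bitsToNat (Rf (fstP r)) / bitsToNat (sndP r) else 0)
    (fracFamilyBits_mem_CH hU hUb hRf hKf hB hBU)

/-- **The parity bit of the fraction sum is a `CH` predicate of the base word**:
`{v | bit (val (Rf v) - 1) of (val (Kf v) + ∑_{0 < q < 2^{p|v|}, ⟨v, bin q⟩ ∈ Bset} ⌊U ⟨v, bin q⟩ 2^{val (Rf v)} / q⌋)} ∈ CH`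
(the sum read off `fracSumBits_mem_CH` at the position `val (Rf v) - 1`, a polynomial-time
recoding). By `CRRParity.testBit_fracSum_eq` this bit is the parity of the number whose CRT digits
the `U ⟨v, bin q⟩` are (HAB Lemmas 4.3–4.4). [cite: HesseAllenderBarrington2002, Lemma 4.3] -/
theorem fracSumBit_mem_CH [DecidablePred (· ∈ Bset)] (hU : {z | U (fstP z) = bitsToNat (sndP z)} ∈ CH)
    (hUb : ∀ w, U w < 2 ^ pU.eval w.length) (hRf : Rf ∈ FP) (hKf : Kf ∈ FP) (hB : Bset ∈ CH)
    (hBU : ∀ r ∈ Bset, bitsToNat (sndP r) % 2 = 1 ∧ U r < bitsToNat (sndP r)) (p : Polynomial ℕ) :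
    ({v | (bitsToNat (Kf v) + ∑ q ∈ (range (2 ^ p.eval v.length)).filter (fun q => 0 < q ∧ boolPair v (encodeNat q) ∈ Bset),
        U (boolPair v (encodeNat q)) * 2 ^ bitsToNat (Rf v) / q).testBit (bitsToNat (Rf v) - 1) = true} : Language Bool) ∈ CH := by
  have hrec : pairFn id (subFn ∘ pairFn Rf (fun _ => encodeNat 1)) ∈ FP :=
    pairFn_mem_FP OracleCompose.id_mem_FP (comp_mem_FP subFn_mem_FP (pairFn_mem_FP hRf (const_mem_FP _)))
  refine mem_CH_of_iff (preimage_mem_CH (fracSumBits_mem_CH hU hUb hRf hKf hB hBU p) hrec) _ fun v => ?_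
  have key : ∀ (F : List Bool → List Bool) (w : List Bool),
      w ∈ F ⁻¹' {z | (∑ i ∈ range (2 ^ p.eval (fstP z).length),
        (if bitsToNat (sndP (boolPair (fstP z) (encodeNat i))) = 0 then bitsToNat (Kf (fstP (boolPair (fstP z) (encodeNat i))))
          else if boolPair (fstP z) (encodeNat i) ∈ Bset then
            U (boolPair (fstP z) (encodeNat i)) * 2 ^ bitsToNat (Rf (fstP (boolPair (fstP z) (encodeNat i)))) /
              bitsToNat (sndP (boolPair (fstP z) (encodeNat i)))
          else 0)).testBit (bitsToNat (sndP z)) = true} ↔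
      (fun z => (∑ i ∈ range (2 ^ p.eval (fstP z).length),
        (if bitsToNat (sndP (boolPair (fstP z) (encodeNat i))) = 0 then bitsToNat (Kf (fstP (boolPair (fstP z) (encodeNat i))))
          else if boolPair (fstP z) (encodeNat i) ∈ Bset then
            U (boolPair (fstP z) (encodeNat i)) * 2 ^ bitsToNat (Rf (fstP (boolPair (fstP z) (encodeNat i)))) /
              bitsToNat (sndP (boolPair (fstP z) (encodeNat i)))
          else 0)).testBit (bitsToNat (sndP z)) = true) (F w) := fun F w => Iff.rfl
  refine Iff.trans ?_ (key _ v).symm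
  simp only [pairFn_apply, Function.comp_apply, fstP_boolPair, sndP_boolPair, subFn_boolPair, bitsToNat_encodeNat, id_eq]
  -- split off the summand `q = 0` and restrict the rest to `Bset`
  rw [sum_ite, sum_ite, sum_const_zero, add_zero]
  have h0 : (range (2 ^ p.eval v.length)).filter (fun q => q = 0) = {0} := by
    ext q; simp
  have h1 : ((range (2 ^ p.eval v.length)).filter (fun q => ¬ q = 0)).filter (fun q => boolPair v (encodeNat q) ∈ Bset) =
      (range (2 ^ p.eval v.length)).filter (fun q => 0 < q ∧ boolPair v (encodeNat q) ∈ Bset) := by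
    rw [filter_filter]
    exact filter_congr fun q _ => by rw [Nat.pos_iff_ne_zero]
  rw [h0, sum_singleton, h1]
  exact Iff.rfl

end FracBits

end Literature.Computability.Complexity
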